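import Mathlib
import Literature.Computability.AlgebraicComplexity.Apolarity
import Literature.Computability.AlgebraicComplexity.ApolarityAction
import Literature.Computability.AlgebraicComplexity.LinSubst
import Literature.Computability.AlgebraicComplexity.OrbitClosure
import Summits.ValiantsHypothesis.ValiantsHypothesis.Theorems.BorderApolarityToricFixedPointsToricLimitIsInitialAux1
import Summits.ValiantsHypothesis.ValiantsHypothesis.Theorems.BorderApolarityToricWitnessObstructionQPInitialSpanDim
import Summits.ValiantsHypothesis.ValiantsHypothesis.Theorems.BorderApolarityToricWitnessObstructionQPInitialSpanIdeal
import Summits.ValiantsHypothesis.ValiantsHypothesis.Theorems.BorderApolarityToricWitnessObstructionQPShadowFeeding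
import Summits.ValiantsHypothesis.ValiantsHypothesis.Theorems.BorderApolarityToricWitnessObstructionQPNoPureOwn

/-!
# Border apolarity, crux `ToricWitnessObstructionQP` (stmt-ValiantsHypothesis-14753) — first structure
# theorems for STABLE normal forms (line `Sketch`, reshape 4, lead c2)

Route `ValiantsHypothesis/BorderApolarity`, crux item `stmt-ValiantsHypothesis-14753`.

The residual of line `Sketch` (reshape 4; `stub_noStableNormalFormQP`, ≡ the crux by
`…StableNormalFormIff.lean`) is about the lowest-`w`-weight initial spans
`J'_k := in_w(Ann_k(g · det_m))` of a stable normal form, which are stable in particular under all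
transvections `∂_y ↦ ∂_y + c ∂_z` (`y` own, `z` unused; clause (SH)).  This file records what the
landed wave-3/4 lemmas give about such spans, in the form future lines will consume:

* `snf_initialSpan_le_homogeneous` — `J'_k` is a space of degree-`k` forms; its dimension is
  `C(m²+k-1,k) - C(m,k)²` (`snf_finrank_initialSpan`, imported).
* `snf_initialSpan_dichotomy` — SHADOW FEEDING: if `J'_k` contains a nonzero PURE-OWN operator then it
  contains EVERY pure-unused monomial operator of degree `k`.
* `snf_initialSpan_noPureOwn` — hence, whenever `C(m²+k-1,k) - C(m,k)² < C(#unused+k-1,k)` (true for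
  all small `k` once `m > 2n+1`: `#unused = m²-n²-1`), `J'_k` has NO nonzero pure-own operator: every
  own form of degree `k` pairs non-trivially with the top-weight degeneration of the `k × k` minors.
* `snf_initialSpan_pureUnused_upward`, `snf_initialSpan_pureOwn_upward` — both events are UPWARD
  CLOSED in the degree (ideal property `snf_X_mul_mem_initialSpan`), so there are thresholds
  `k_Z ≤ k_U` ("all pure-unused monomials are initial annihilators from degree `k_Z` on", "pure-own
  initial annihilators exist from degree `k_U` on"; `k_Z ≤ k_U` is the dichotomy, and
  `k_Z > max{k : C(m²+k-1,k) - C(m,k)² < C(m²-n²+k-2,k)}` by dimension).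

These are necessary conditions on any counterexample to the crux; they already explain the failure
of the naive Grenet completions at `(3,7)`/`(3,8)` observed by lead c1 (an own variable occurring in a
single entry of the matrix makes `∂_y²` an initial annihilator in degree 2, while a `2 × 2` minor free
of own variables is a pure-unused top form).
-/

open MvPolynomial Filter
open scoped BigOperators Matrix
open Literature.Computability.AlgebraicComplexity

-- the mandated summit-side namespace repeats a component by design (single-problem summit)
set_option linter.dupNamespace false

namespace Summit.ValiantsHypothesis.ValiantsHypothesis.Theorems.BorderApolarityToricWitnessObstructionQP

section General

variable {σ : Type} [Fintype σ] [DecidableEq σ]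

omit [Fintype σ] [DecidableEq σ] in
/-- The lowest-weight initial span of `Ann_k(F)` consists of degree-`k` forms. [folklore] -/
theorem snf_initialSpan_le_homogeneous (w : σ → ℤ) (F : MvPolynomial σ ℂ) (k : ℕ) :
    Submodule.span ℂ {D' : MvPolynomial σ ℂ | ∃ E ∈ annihilatorOfDegree F k, ∃ ν : ℤ,
        D' = weightedHomogeneousComponent w ν E ∧
          ∀ ν' : ℤ, ν' < ν → weightedHomogeneousComponent w ν' E = 0} ≤
      homogeneousSubmodule σ ℂ k := by
  refine Submodule.span_le.2 ?_
  rintro _ ⟨E, hE, ν, rfl, -⟩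
  exact (mem_homogeneousSubmodule k _).2
    (BorderApolarityToricFixedPoints.tli_isHomogeneous_weightedHomogeneousComponent w ν hE.1)

/-- **Dichotomy (shadow feeding) for initial spans.**  If the degree-`k` initial span is stable under
all transvections `∂_y ↦ ∂_y + c ∂_z` (`ess y`, `¬ ess z`) and contains a nonzero pure-own operator,
then it contains every pure-unused monomial operator of degree `k`. [folklore] -/
theorem snf_initialSpan_dichotomy (ess : σ → Prop) [DecidablePred ess] (w : σ → ℤ)
    (F : MvPolynomial σ ℂ) (k : ℕ)
    (hSH : ∀ u z : σ, ess u → ¬ ess z → ∀ c : ℂ,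
      ∀ D ∈ Submodule.span ℂ {D' : MvPolynomial σ ℂ | ∃ E ∈ annihilatorOfDegree F k, ∃ ν : ℤ,
        D' = weightedHomogeneousComponent w ν E ∧
          ∀ ν' : ℤ, ν' < ν → weightedHomogeneousComponent w ν' E = 0},
      linSubst σ ℂ (1 + c • Matrix.single z u (1 : ℂ)) D ∈
        Submodule.span ℂ {D' : MvPolynomial σ ℂ | ∃ E ∈ annihilatorOfDegree F k, ∃ ν : ℤ,
          D' = weightedHomogeneousComponent w ν E ∧
            ∀ ν' : ℤ, ν' < ν → weightedHomogeneousComponent w ν' E = 0})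
    {D : MvPolynomial σ ℂ}
    (hD : D ∈ Submodule.span ℂ {D' : MvPolynomial σ ℂ | ∃ E ∈ annihilatorOfDegree F k, ∃ ν : ℤ,
        D' = weightedHomogeneousComponent w ν E ∧
          ∀ ν' : ℤ, ν' < ν → weightedHomogeneousComponent w ν' E = 0})
    (hD0 : D ≠ 0) (hown : ∀ d ∈ D.support, ∀ i, ¬ ess i → d i = 0)
    (d : σ →₀ ℕ) (hd : d.degree = k) (hdz : ∀ i, ess i → d i = 0) :
    monomial d (1 : ℂ) ∈ Submodule.span ℂ {D' : MvPolynomial σ ℂ | ∃ E ∈ annihilatorOfDegree F k,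
      ∃ ν : ℤ, D' = weightedHomogeneousComponent w ν E ∧
        ∀ ν' : ℤ, ν' < ν → weightedHomogeneousComponent w ν' E = 0} :=
  snf_shadow_feeding ess _ k hSH D hD hD0
    ((mem_homogeneousSubmodule k D).1 (snf_initialSpan_le_homogeneous w F k hD)) hown d hd hdz

end General

/-- **No pure-own initial annihilators below the unused dimension.**  For `g ∈ GL_{m²}`, weights
`w`, and a degree `k` with `C(m²+k-1,k) - C(m,k)² < C(#unused + k - 1, k)`: if the degree-`k`
lowest-weight initial span of `Ann_k(g · det_m)` is transvection-stable (clause (SH) of the stable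
normal form, one transvection at a time), then it contains no nonzero operator supported on the own
variables alone. [folklore] -/
theorem snf_initialSpan_noPureOwn : ∀ (m k : ℕ) (ess : Fin m × Fin m → Prop) [DecidablePred ess]
    (g : GL (Fin m × Fin m) ℂ) (w : Fin m × Fin m → ℤ),
    (∀ u z : Fin m × Fin m, ess u → ¬ ess z → ∀ c : ℂ,
      ∀ D ∈ Submodule.span ℂ {D' : MvPolynomial (Fin m × Fin m) ℂ |
        ∃ E ∈ annihilatorOfDegree
          (linSubst (Fin m × Fin m) ℂ (g : Matrix (Fin m × Fin m) (Fin m × Fin m) ℂ) (detPoly (Fin m) ℂ)) k,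
        ∃ ν : ℤ, D' = weightedHomogeneousComponent w ν E ∧
          ∀ ν' : ℤ, ν' < ν → weightedHomogeneousComponent w ν' E = 0},
      linSubst (Fin m × Fin m) ℂ (1 + c • Matrix.single z u (1 : ℂ)) D ∈
        Submodule.span ℂ {D' : MvPolynomial (Fin m × Fin m) ℂ |
          ∃ E ∈ annihilatorOfDegree
            (linSubst (Fin m × Fin m) ℂ (g : Matrix (Fin m × Fin m) (Fin m × Fin m) ℂ) (detPoly (Fin m) ℂ)) k,
          ∃ ν : ℤ, D' = weightedHomogeneousComponent w ν E ∧
            ∀ ν' : ℤ, ν' < ν → weightedHomogeneousComponent w ν' E = 0}) →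
    Nat.choose (m * m + k - 1) k - (Nat.choose m k) ^ 2 <
      Nat.choose (Fintype.card {i : Fin m × Fin m // ¬ ess i} + k - 1) k →
    ∀ D ∈ Submodule.span ℂ {D' : MvPolynomial (Fin m × Fin m) ℂ |
        ∃ E ∈ annihilatorOfDegree
          (linSubst (Fin m × Fin m) ℂ (g : Matrix (Fin m × Fin m) (Fin m × Fin m) ℂ) (detPoly (Fin m) ℂ)) k,
        ∃ ν : ℤ, D' = weightedHomogeneousComponent w ν E ∧
          ∀ ν' : ℤ, ν' < ν → weightedHomogeneousComponent w ν' E = 0},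
      (∀ d ∈ D.support, ∀ i, ¬ ess i → d i = 0) → D = 0 := by
  intro m k ess _ g w hSH hdim
  refine snf_noPureOwn_of_finrank_lt ess _ k (snf_initialSpan_le_homogeneous w _ k) hSH ?_
  rw [snf_finrank_initialSpan m k g w]
  exact hdim

section Upward

variable {σ : Type} [Fintype σ] [DecidableEq σ]

/-- **Pure-unused saturation is upward closed in the degree** (ideal property of the initial spans):
if every pure-unused monomial operator of degree `k` is a lowest-weight initial annihilator, so is every
pure-unused monomial operator of degree `k + 1`. [folklore] -/
theorem snf_initialSpan_pureUnused_upward (ess : σ → Prop) (w : σ → ℤ) (F : MvPolynomial σ ℂ)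
    (k : ℕ)
    (hall : ∀ d : σ →₀ ℕ, d.degree = k → (∀ i, ess i → d i = 0) →
      monomial d (1 : ℂ) ∈ Submodule.span ℂ {D' : MvPolynomial σ ℂ | ∃ E ∈ annihilatorOfDegree F k,
        ∃ ν : ℤ, D' = weightedHomogeneousComponent w ν E ∧
          ∀ ν' : ℤ, ν' < ν → weightedHomogeneousComponent w ν' E = 0}) :
    ∀ d : σ →₀ ℕ, d.degree = k + 1 → (∀ i, ess i → d i = 0) →
      monomial d (1 : ℂ) ∈ Submodule.span ℂ {D' : MvPolynomial σ ℂ |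
        ∃ E ∈ annihilatorOfDegree F (k + 1), ∃ ν : ℤ, D' = weightedHomogeneousComponent w ν E ∧
          ∀ ν' : ℤ, ν' < ν → weightedHomogeneousComponent w ν' E = 0} := by
  intro d hd hdz
  -- pick a variable in the support of `d` (it has degree `k + 1 > 0`), necessarily unused
  have hd0 : d ≠ 0 := by
    rintro rfl
    simp at hd
  obtain ⟨i, hi⟩ := Finsupp.support_nonempty_iff.2 hd0
  have hi1 : 1 ≤ d i := Nat.one_le_iff_ne_zero.2 (Finsupp.mem_support_iff.1 hi)
  set d' : σ →₀ ℕ := d - Finsupp.single i 1 with hd'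
  have hdd' : d = d' + Finsupp.single i 1 := by
    rw [hd', tsub_add_cancel_of_le (Finsupp.single_le_iff.2 hi1)]
  have hdeg' : d'.degree = k := by
    have h := congrArg Finsupp.degree hdd'
    rw [map_add, Finsupp.degree_single, hd] at h
    omega
  have hdz' : ∀ j, ess j → d' j = 0 := fun j hj => by
    rw [hd', Finsupp.tsub_apply, hdz j hj, Nat.zero_sub]
  have hmem := snf_X_mul_mem_initialSpan w F k i _ (hall d' hdeg' hdz')
  have hX : (X i : MvPolynomial σ ℂ) * monomial d' 1 = monomial d 1 := by
    rw [X, monomial_mul, one_mul, add_comm, ← hdd']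
  rwa [hX] at hmem

/-- **Pure-own initial annihilators persist upward in the degree**: multiplying a nonzero pure-own
element of the degree-`k` initial span by an own variable gives one in degree `k + 1`. [folklore] -/
theorem snf_initialSpan_pureOwn_upward (ess : σ → Prop) (w : σ → ℤ) (F : MvPolynomial σ ℂ)
    (k : ℕ) (u : σ) (hu : ess u) {D : MvPolynomial σ ℂ}
    (hD : D ∈ Submodule.span ℂ {D' : MvPolynomial σ ℂ | ∃ E ∈ annihilatorOfDegree F k, ∃ ν : ℤ,
        D' = weightedHomogeneousComponent w ν E ∧
          ∀ ν' : ℤ, ν' < ν → weightedHomogeneousComponent w ν' E = 0})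
    (hD0 : D ≠ 0) (hown : ∀ d ∈ D.support, ∀ i, ¬ ess i → d i = 0) :
    X u * D ∈ Submodule.span ℂ {D' : MvPolynomial σ ℂ | ∃ E ∈ annihilatorOfDegree F (k + 1),
        ∃ ν : ℤ, D' = weightedHomogeneousComponent w ν E ∧
          ∀ ν' : ℤ, ν' < ν → weightedHomogeneousComponent w ν' E = 0} ∧
      X u * D ≠ 0 ∧ (∀ d ∈ (X u * D).support, ∀ i, ¬ ess i → d i = 0) := by
  refine ⟨snf_X_mul_mem_initialSpan w F k u D hD, mul_ne_zero (X_ne_zero u) hD0, ?_⟩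
  intro d hd i hi
  rw [mem_support_iff, coeff_X_mul'] at hd
  split_ifs at hd with hmem
  · have hsupp : d - Finsupp.single u 1 ∈ D.support := mem_support_iff.2 hd
    have h0 := hown _ hsupp i hi
    have hui : u ≠ i := fun h => hi (h ▸ hu)
    rw [Finsupp.tsub_apply, Finsupp.single_apply, if_neg hui, Nat.sub_zero] at h0
    exact h0
  · exact absurd rfl hd

end Upward

section OwnDegree

variable {σ : Type} [Fintype σ] [DecidableEq σ]

omit [Fintype σ] [DecidableEq σ] in
/-- A monomial operator annihilating `F` lies in every lowest-weight initial span of `Ann_k(F)` of its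
degree (it is its own lowest-weight form). [folklore] -/
theorem snf_monomial_mem_initialSpan (w : σ → ℤ) (F : MvPolynomial σ ℂ) (k : ℕ) (d : σ →₀ ℕ)
    (hd : d.degree = k) (hann : apolarAction (monomial d (1 : ℂ)) F = 0) :
    monomial d (1 : ℂ) ∈ Submodule.span ℂ {D' : MvPolynomial σ ℂ | ∃ E ∈ annihilatorOfDegree F k,
      ∃ ν : ℤ, D' = weightedHomogeneousComponent w ν E ∧
        ∀ ν' : ℤ, ν' < ν → weightedHomogeneousComponent w ν' E = 0} := by
  classical
  refine Submodule.subset_span ⟨monomial d 1, ⟨isHomogeneous_monomial _ hd, hann⟩,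
    Finsupp.weight w d, ?_, ?_⟩
  · exact ((isWeightedHomogeneous_monomial w d (1 : ℂ) rfl).weightedHomogeneousComponent_same).symm
  · intro ν' hν'
    exact (isWeightedHomogeneous_monomial w d (1 : ℂ) rfl).weightedHomogeneousComponent_ne ν' hν'.ne

end OwnDegree

/-- **Own variables have large degree in a stable normal form.**  Under the hypotheses of
`snf_initialSpan_noPureOwn` (transvection-stability of the degree-`k` initial span and the dimension
inequality `C(m²+k-1,k) - C(m,k)² < C(#unused+k-1,k)`), NO pure-own monomial operator of degree `k`
annihilates `g · det_m`; in particular `∂_y^k (g · det_m) ≠ 0` for every own variable `y`: each own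
variable has degree `≥ k` in `g · det_m`, hence its `m × m` coefficient matrix in the entries of
`g · x` has rank `≥ k`.  (For `k = 2` this is the mechanism behind the failure of all Grenet-type
completions: a first-layer variable of Grenet's matrix occurs in a single entry.) [folklore] -/
theorem snf_ownMonomial_not_annihilate (m k : ℕ) (ess : Fin m × Fin m → Prop) [DecidablePred ess]
    (g : GL (Fin m × Fin m) ℂ) (w : Fin m × Fin m → ℤ)
    (hSH : ∀ u z : Fin m × Fin m, ess u → ¬ ess z → ∀ c : ℂ,
      ∀ D ∈ Submodule.span ℂ {D' : MvPolynomial (Fin m × Fin m) ℂ |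
        ∃ E ∈ annihilatorOfDegree
          (linSubst (Fin m × Fin m) ℂ (g : Matrix (Fin m × Fin m) (Fin m × Fin m) ℂ) (detPoly (Fin m) ℂ)) k,
        ∃ ν : ℤ, D' = weightedHomogeneousComponent w ν E ∧
          ∀ ν' : ℤ, ν' < ν → weightedHomogeneousComponent w ν' E = 0},
      linSubst (Fin m × Fin m) ℂ (1 + c • Matrix.single z u (1 : ℂ)) D ∈
        Submodule.span ℂ {D' : MvPolynomial (Fin m × Fin m) ℂ |
          ∃ E ∈ annihilatorOfDegree
            (linSubst (Fin m × Fin m) ℂ (g : Matrix (Fin m × Fin m) (Fin m × Fin m) ℂ) (detPoly (Fin m) ℂ)) k,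
          ∃ ν : ℤ, D' = weightedHomogeneousComponent w ν E ∧
            ∀ ν' : ℤ, ν' < ν → weightedHomogeneousComponent w ν' E = 0})
    (hdim : Nat.choose (m * m + k - 1) k - (Nat.choose m k) ^ 2 <
      Nat.choose (Fintype.card {i : Fin m × Fin m // ¬ ess i} + k - 1) k)
    (d : Fin m × Fin m →₀ ℕ) (hd : d.degree = k) (hown : ∀ i, ¬ ess i → d i = 0) :
    apolarAction (monomial d (1 : ℂ))
      (linSubst (Fin m × Fin m) ℂ (g : Matrix (Fin m × Fin m) (Fin m × Fin m) ℂ) (detPoly (Fin m) ℂ)) ≠ 0 := by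
  classical
  intro hann
  have hmem := snf_monomial_mem_initialSpan w _ k d hd hann
  have h0 := snf_initialSpan_noPureOwn m k ess g w hSH hdim _ hmem (fun d' hd' i hi => by
    rw [support_monomial, if_neg one_ne_zero, Finset.mem_singleton] at hd'
    rw [hd']
    exact hown i hi)
  exact one_ne_zero ((monomial_eq_zero).1 h0)

end Summit.ValiantsHypothesis.ValiantsHypothesis.Theorems.BorderApolarityToricWitnessObstructionQP
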